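import Literature.Analysis.FluidPDE.PassiveScalarClassicalEnergy
import Literature.Analysis.FunctionSpaces.TorusFourierMultipliers
import Literature.Analysis.FunctionSpaces.TorusFourierConvolution
import Literature.Analysis.FunctionSpaces.TorusAxisAverage
import Literature.Analysis.FunctionSpaces.TorusSpectralWeakDerivative
import Literature.Analysis.FunctionSpaces.TorusTestFunction
import Literature.Analysis.FunctionSpaces.TorusEnstrophyOrthogonality
import HarnessLib

/-!
# Shear flows decouple the streamwise Fourier fibres of a passive scalar; bare-rate damping of the high fibres

Setting: the flat torus `T^d = UnitAddTorus d`, a classical solution `w` of the advection–diffusion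
equation `∂ₜw + u·∇w = κΔw` (`Torus.IsClassicalScalarTransportOn S κ u w`) and a time interval
`[t₀, t₁] ⊆ S` on which the velocity is a **shear along the `i`-th axis that does not depend on
`xᵢ`**: `u t x = b(t, x) eᵢ` with `b (x + s eᵢ) = b x` (in the tree's vocabulary: `u t x = (u t x i) • eᵢ`
and `u t (x + Pi.single i s) = u t x`).  Writing `w(t) = ∑_k c_k(t) e_k`, the equation for the
coefficients is `ċ_k = -𝓕(b ∂ᵢ w)(k) - 4π²κ|k|² c_k`, and multiplication by `b` and `∂ᵢ` do not move the
streamwise index `kᵢ`: the energy carried by any block of modes `B_K = {k : K ≤ |kᵢ|}` obeys the EXACT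
balance `d/dt ∑_{k ∈ B_K} |c_k|² = -8π²κ ∑_{k ∈ B_K} |k|² |c_k|²` (the transport term is skew on every
fibre `{kᵢ = m}`).  This is the elementary starting point of the enhanced-dissipation literature for
shear flows (Bedrossian–Coti Zelati 2017, §1: "the equation decouples in the streamwise frequency `k`",
with the trivial bound `‖f_k(t)‖ ≤ e^{-νk²t}‖f_k(0)‖` before any enhancement); here only the bare
rate is recorded, which is what the cell `ad-ideate` consumes.

## Results (all proved; no named facts, no axioms)

* `Torus.highModeEnergy i K f = ∑' k, [K ≤ |kᵢ|] ‖𝓕(↑f)(k)‖ₑ²` — the energy of a real scalar carried by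
  the streamwise fibres `|kᵢ| ≥ K` (definition; the cell's `highModeEnergy K` is the case `i = 0` on
  `𝕋²`, definitionally).
* `Torus.re_tsum_conj_mFourierCoeff_mul_shear_eq_zero` — **the transport term is skew on streamwise
  blocks**: for smooth complex `W`, smooth real `β` invariant under the axis translations, and every
  `K`, `Re ∑_{K ≤ |kᵢ|} conj(𝓕W(k)) · 𝓕(β ∂ᵢW)(k) = 0` (fibre projections as Fourier multipliers,
  `Torus.multiplier`; the complementary block is a FINITE sum of fibres, each an eigenfunction of the
  axis translations, `Torus.mFourierCoeff_comp_add_single`; on the block itself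
  `Re(W̄ β ∂ᵢW) = ½ β ∂ᵢ|W|²` integrates to zero).
* `Torus.IsClassicalScalarTransportOn.highModeEnergy_le_exp_mul` (and the real form
  `tsum_high_le_exp_mul`) — **bare-rate damping of the high fibres**:
  `E_{≥K}(w(t₁)) ≤ e^{-8π²κK²(t₁-t₀)} E_{≥K}(w(t₀))` (`0 ≤ K`, `0 ≤ κ`).
* `Torus.IsClassicalScalarTransportOn.scalarL2Sq_sub_tsum_high_le` — the low block
  `‖w(t)‖² - E_{≥K}(w(t))` is non-increasing.
* `Torus.IsClassicalScalarTransportOn.scalarL2Sq_add_highModeEnergy_le` — the form consumed by the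
  cell (`ad-ideate`, seat ad-p2, route `SawtoothPulseCascade`, crux line `K1LocalisedCascade.Spectral`,
  stub S2 `stub_shearSlotDamping`): `‖w(t₁)‖² + (1 - e^{-8π²κK²(t₁-t₀)})·E_{≥K}(w(t₀)) ≤ ‖w(t₀)‖²` in
  `ℝ≥0∞`, for `0 ≤ K` (for `K < 0` the block is everything and the statement would assert a uniform
  decay of the total energy, which is false for constants — the stub needs the side condition `0 ≤ K`).

Method: the coefficient ODE from differentiation under `∫_{T^d}` within the time interval
(`IsSmoothSpaceTimeOn.hasDerivWithinAt_integral`), exact bookkeeping for FINITE blocks of modes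
(fundamental theorem of calculus), and ONE dominated-convergence passage to the infinite block in which
only the transport pairing `∑_{k∈A} conj(c_k)𝓕(b∂ᵢw)(k)` has to converge (its limit has zero real part);
no Grönwall.  WHAT THIS IS NOT: no enhanced dissipation, no statement about the Navier–Stokes cascade
itself (the slot instantiation for `SawtoothCascade.CascadeParams.field` is left to the consumer: on an
H half-slot the field is `(rateH j t · U j (x₂), 0)`, `SawtoothCascade.CascadeParams.field_eq_of_mem_H`).
[cite: BedrossianCotiZelati2017, §1 (after Thm. 1.2: "after taking a Fourier transform in the x-direction, the problem decouples in frequency and the decay estimate is k-by-k") and §2 ("both equations decouple in k")]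
[cite: Grafakos2014, Prop. 3.1.2 (5) (coefficients of translates), Prop. 3.2.7 (3) (Parseval)]
[cite: DEIJ2022, (1.2) (the energy identity the blocks refine)] [problem: turb]
-/

open MeasureTheory Set Filter UnitAddTorus Complex
open scoped InnerProductSpace ContDiff ENNReal NNReal ComplexConjugate

noncomputable section

namespace Literature.Analysis.FluidPDE

namespace Torus

open _root_.Topology
open Literature.Analysis.FunctionSpaces Literature.Analysis.FunctionSpaces.Torus

variable {d : Type*} [Fintype d] [DecidableEq d]

/-! ## Part 1 — streamwise blocks of Fourier modes and their energies -/

/-- The energy of a real scalar `f` on `T^d` carried by the streamwise Fourier fibres `|kᵢ| ≥ K`: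
`∑_{k : K ≤ |kᵢ|} ‖𝓕(↑f)(k)‖²` in `[0, ∞]` (complexified coefficients; `0`-junk for non-integrable `f`
like the tree's spectral functionals).  The cell `ad-ideate`'s `highModeEnergy K` on `𝕋²` is the case
`i = 0`. [cite: BedrossianCotiZelati2017, §1 (streamwise frequency blocks)] -/
def highModeEnergy (i : d) (K : ℝ) (f : UnitAddTorus d → ℝ) : ℝ≥0∞ :=
  ∑' k : d → ℤ, if K ≤ |((k i : ℤ) : ℝ)| then ‖mFourierCoeff (fun x => (f x : ℂ)) k‖ₑ ^ 2 else 0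

/-- The symbol of the block projection `P_{≥K}`: `χ(k) = [K ≤ |kᵢ|] · id`.
[cite: Grafakos2014, §4.3 (Fourier multipliers)] -/
def highSymbol (i : d) (K : ℝ) : (d → ℤ) → ℂ →L[ℂ] ℂ :=
  fun k => (if K ≤ |((k i : ℤ) : ℝ)| then (1 : ℂ) else 0) • ContinuousLinearMap.id ℂ ℂ

/-- The symbol of the fibre projection `P_{kᵢ = m}`. [cite: Grafakos2014, §4.3 (Fourier multipliers)] -/
def fibreSymbol (i : d) (m : ℤ) : (d → ℤ) → ℂ →L[ℂ] ℂ :=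
  fun k => (if k i = m then (1 : ℂ) else 0) • ContinuousLinearMap.id ℂ ℂ

omit [DecidableEq d] in
/-- Block symbols have polynomial growth (they are bounded by `1`). [folklore] -/
private theorem hasPolyGrowth_highSymbol (i : d) (K : ℝ) : HasPolyGrowth (highSymbol (d := d) i K) := by
  refine hasPolyGrowth_smul (C := 1) (s := 0) (fun k => ?_) _
  rw [pow_zero, mul_one]
  split_ifs <;> simp

omit [DecidableEq d] in
/-- Fibre symbols have polynomial growth. [folklore] -/
private theorem hasPolyGrowth_fibreSymbol (i : d) (m : ℤ) : HasPolyGrowth (fibreSymbol (d := d) i m) := by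
  refine hasPolyGrowth_smul (C := 1) (s := 0) (fun k => ?_) _
  rw [pow_zero, mul_one]
  split_ifs <;> simp

omit [Fintype d] [DecidableEq d] in
/-- The block symbol acts by the indicator of the block. [folklore] -/
@[simp] private theorem highSymbol_apply (i : d) (K : ℝ) (k : d → ℤ) (z : ℂ) :
    highSymbol i K k z = (if K ≤ |((k i : ℤ) : ℝ)| then (1 : ℂ) else 0) * z := by
  unfold highSymbol
  split_ifs <;> simp

omit [Fintype d] [DecidableEq d] in
/-- The fibre symbol acts by the indicator of the fibre. [folklore] -/
@[simp] private theorem fibreSymbol_apply (i : d) (m : ℤ) (k : d → ℤ) (z : ℂ) :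
    fibreSymbol i m k z = (if k i = m then (1 : ℂ) else 0) * z := by
  unfold fibreSymbol
  split_ifs <;> simp

/-! ### Elementary Fourier lemmas: finite sums, constants, translation along an axis -/

omit [DecidableEq d] in
/-- Fourier coefficients of a finite sum. [folklore] -/
private theorem mFourierCoeff_finset_sum {ι : Type*} (s : Finset ι) {f : ι → UnitAddTorus d → ℂ}
    (hf : ∀ j ∈ s, Integrable (f j) volume) (k : d → ℤ) :
    mFourierCoeff (fun x => ∑ j ∈ s, f j x) k = ∑ j ∈ s, mFourierCoeff (f j) k := by
  classical
  induction s using Finset.induction_on with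
  | empty =>
    simp [mFourierCoeff_eq_integral_conj_mul]
  | insert a s ha ih =>
    have hfa : Integrable (f a) volume := hf a (Finset.mem_insert_self a s)
    have hfs : ∀ j ∈ s, Integrable (f j) volume := fun j hj => hf j (Finset.mem_insert_of_mem hj)
    have hsum : Integrable (fun x => ∑ j ∈ s, f j x) volume := integrable_finsetSum s hfs
    simp_rw [Finset.sum_insert ha]
    rw [show (fun x => f a x + ∑ j ∈ s, f j x) = f a + fun x => ∑ j ∈ s, f j x from rfl,
      mFourierCoeff_add hfa hsum, ih hfs]

omit [DecidableEq d] in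
/-- Fourier coefficients of a complex constant multiple. [folklore] -/
private theorem mFourierCoeff_const_mul (a : ℂ) (f : UnitAddTorus d → ℂ) (k : d → ℤ) :
    mFourierCoeff (fun x => a * f x) k = a * mFourierCoeff f k := by
  simp only [mFourierCoeff_eq_integral_conj_mul, ← integral_const_mul]
  refine integral_congr_ae (ae_of_all _ fun x => ?_)
  ring

omit [Fintype d] in
/-- The coordinate line through `x` in direction `eᵢ` is the axis translate by `Pi.single i ↑t`.
[folklore] -/
private theorem proj_smul_single (i : d) (t : ℝ) :
    proj (t • EuclideanSpace.single i (1 : ℝ)) = (Pi.single i ((t : ℝ) : UnitAddCircle) : UnitAddTorus d) := by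
  funext j
  rw [proj_apply, PiLp.smul_apply, EuclideanSpace.single, PiLp.single_apply]
  by_cases hj : j = i
  · subst hj; simp
  · simp [hj]

omit [Fintype d] in
/-- Partial derivatives commute with translations: `∂ᵢ f (x + v) = ∂ᵢ (f(· + v)) x`. [folklore] -/
private theorem partialDeriv_apply_add {F : Type*} [NormedAddCommGroup F] [NormedSpace ℝ F]
    (i : d) (f : UnitAddTorus d → F) (x v : UnitAddTorus d) :
    partialDeriv i f (x + v) = partialDeriv i (fun y => f (y + v)) x := by
  simp only [partialDeriv, Torus.lineDeriv, add_right_comm]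

omit [Fintype d] in
/-- A function invariant under the translations along the `i`-th axis has `∂ᵢ = 0`. [folklore] -/
private theorem partialDeriv_eq_zero_of_forall_add_single {F : Type*} [NormedAddCommGroup F] [NormedSpace ℝ F]
    {i : d} {β : UnitAddTorus d → F} (hβ : ∀ (s : UnitAddCircle) (x : UnitAddTorus d), β (x + Pi.single i s) = β x)
    (x : UnitAddTorus d) : partialDeriv i β x = 0 := by
  have h : (fun t : ℝ => β (x + proj (t • EuclideanSpace.single i (1 : ℝ)))) = fun _ => β x := by
    funext t; rw [proj_smul_single, hβ]
  simp only [partialDeriv, Torus.lineDeriv, h, deriv_const]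

omit [DecidableEq d] in
/-- Translates of smooth functions are continuous (all that the uniqueness argument needs). [folklore] -/
private theorem continuous_comp_add_right {F : Type*} [NormedAddCommGroup F] [NormedSpace ℝ F]
    {f : UnitAddTorus d → F} (hf : IsSmooth f) (v : UnitAddTorus d) : Continuous fun x => f (x + v) :=
  hf.continuous.comp (continuous_id.add continuous_const)

omit [Fintype d] [DecidableEq d] in
/-- A character of the circle never vanishes. [folklore] -/
private theorem fourier_coe_ne_zero (n : ℤ) (s : UnitAddCircle) : (fourier n s : ℂ) ≠ 0 := by
  intro h
  have h1 := fourier_mul_fourier_neg n s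
  rw [h, zero_mul] at h1
  exact zero_ne_one h1

/-- **Streamwise support from an axis eigen-relation.** If `g (x + s eᵢ) = e_m(s) g x` for all axis
translations, then `𝓕g(k) = 0` unless `kᵢ = m` (translate by half a period of `e_{kᵢ - m}`; the case
`m = 0` is the tree's `mFourierCoeff_eq_zero_of_forall_add_single`). [cite: Grafakos2014, Prop. 3.1.2 (5)] -/
theorem mFourierCoeff_eq_zero_of_forall_add_single_eq_fourier_mul {g : UnitAddTorus d → ℂ} {i : d} {m : ℤ}
    (hg : ∀ (s : UnitAddCircle) (x : UnitAddTorus d), g (x + Pi.single i s) = fourier m s * g x)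
    {k : d → ℤ} (hk : k i ≠ m) : mFourierCoeff g k = 0 := by
  have hn : k i - m ≠ 0 := sub_ne_zero.mpr hk
  set s₀ : UnitAddCircle := (((1 : ℝ) / 2 / (k i - m : ℤ) : ℝ) : UnitAddCircle) with hs₀
  have h1 := mFourierCoeff_comp_add_single g k i s₀
  have h2 : (fun x => g (x + Pi.single i s₀)) = fun x => fourier m s₀ * g x := funext (hg s₀)
  rw [h2, mFourierCoeff_const_mul] at h1
  have hki : fourier (k i) s₀ = fourier m s₀ * fourier (k i - m) s₀ := by
    rw [← fourier_add, show m + (k i - m) = k i by abel]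
  rw [hki, fourier_half_inv hn, smul_eq_mul] at h1
  -- `e_m(s₀) 𝓕g(k) = -e_m(s₀) 𝓕g(k)`
  have h3 : (2 * fourier m s₀ : ℂ) * mFourierCoeff g k = 0 := by linear_combination h1
  rcases mul_eq_zero.mp h3 with h | h
  · exact absurd h (mul_ne_zero two_ne_zero (fourier_coe_ne_zero m s₀))
  · exact h

/-! ### The fibre and block projections of a smooth function -/

section Projections

variable {W : UnitAddTorus d → ℂ} (hW : IsSmooth W) (i : d)
include hW

/-- Coefficients of the block projection. [folklore] -/
private theorem mFourierCoeff_multiplier_highSymbol (K : ℝ) (k : d → ℤ) :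
    mFourierCoeff (Torus.multiplier (highSymbol i K) W) k =
      (if K ≤ |((k i : ℤ) : ℝ)| then (1 : ℂ) else 0) * mFourierCoeff W k := by
  rw [hW.mFourierCoeff_multiplier (hasPolyGrowth_highSymbol i K), highSymbol_apply]

/-- Coefficients of the fibre projection. [folklore] -/
private theorem mFourierCoeff_multiplier_fibreSymbol (m : ℤ) (k : d → ℤ) :
    mFourierCoeff (Torus.multiplier (fibreSymbol i m) W) k =
      (if k i = m then (1 : ℂ) else 0) * mFourierCoeff W k := by
  rw [hW.mFourierCoeff_multiplier (hasPolyGrowth_fibreSymbol i m), fibreSymbol_apply]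

/-- **Fibres are eigenfunctions of the axis translations**: `P_{kᵢ=m}W (x + s eᵢ) = e_m(s) P_{kᵢ=m}W (x)`.
[cite: Grafakos2014, Prop. 3.1.2 (5)] -/
theorem multiplier_fibreSymbol_add_single (m : ℤ) (s : UnitAddCircle) (x : UnitAddTorus d) :
    Torus.multiplier (fibreSymbol i m) W (x + Pi.single i s) =
      fourier m s * Torus.multiplier (fibreSymbol i m) W x := by
  have hf : IsSmooth (Torus.multiplier (fibreSymbol i m) W) := hW.multiplier (hasPolyGrowth_fibreSymbol i m)
  have hc2 : Continuous fun y => (fourier m s : ℂ) * Torus.multiplier (fibreSymbol i m) W y :=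
    continuous_const.mul hf.continuous
  have key := eq_of_forall_mFourierCoeff_eq (continuous_comp_add_right hf (Pi.single i s)) hc2 (fun k => by
      rw [mFourierCoeff_comp_add_single, mFourierCoeff_const_mul,
        mFourierCoeff_multiplier_fibreSymbol hW i m k, smul_eq_mul]
      by_cases hk : k i = m
      · rw [hk, if_pos rfl]
      · rw [if_neg hk]; ring)
  exact congrFun key x

/-- `W - P_{≥K} W` is the finite sum of the fibres `|m| < K`. [folklore] -/
private theorem sub_multiplier_highSymbol_eq_sum (K : ℝ) (x : UnitAddTorus d) :
    W x - Torus.multiplier (highSymbol i K) W x =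
      ∑ m ∈ (Finset.Icc (-⌈K⌉) ⌈K⌉).filter (fun m : ℤ => |((m : ℤ) : ℝ)| < K),
        Torus.multiplier (fibreSymbol i m) W x := by
  set M := (Finset.Icc (-⌈K⌉) ⌈K⌉).filter (fun m : ℤ => |((m : ℤ) : ℝ)| < K) with hM
  have hP : IsSmooth (Torus.multiplier (highSymbol i K) W) := hW.multiplier (hasPolyGrowth_highSymbol i K)
  have hf : ∀ m, IsSmooth (Torus.multiplier (fibreSymbol i m) W) := fun m =>
    hW.multiplier (hasPolyGrowth_fibreSymbol i m)
  have hsum : IsSmooth (fun x => ∑ m ∈ M, Torus.multiplier (fibreSymbol i m) W x) := by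
    have hl : lift (fun x => ∑ m ∈ M, Torus.multiplier (fibreSymbol i m) W x) =
        fun z => ∑ m ∈ M, lift (Torus.multiplier (fibreSymbol i m) W) z := rfl
    unfold IsSmooth; rw [hl]; exact ContDiff.sum fun m _ => hf m
  have hmem : ∀ n : ℤ, n ∈ M ↔ |((n : ℤ) : ℝ)| < K := by
    intro n
    rw [hM, Finset.mem_filter, Finset.mem_Icc]
    constructor
    · exact fun h => h.2
    · intro h
      refine ⟨⟨?_, ?_⟩, h⟩
      · have h1 : -((n : ℤ) : ℝ) < K := (neg_le_abs _).trans_lt h |>.trans_le le_rfl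
        have h2 : (-K : ℝ) ≤ ((n : ℤ) : ℝ) := by linarith
        have h3 : -K ≤ (⌈K⌉ : ℝ) - K + (n : ℝ) := by linarith [Int.le_ceil K]
        have : (-⌈K⌉ : ℤ) ≤ n := by
          have h4 : (-(⌈K⌉ : ℝ)) ≤ (n : ℝ) := by linarith [Int.le_ceil K]
          exact_mod_cast h4
        exact this
      · have h1 : ((n : ℤ) : ℝ) < K := (le_abs_self _).trans_lt h
        have h4 : (n : ℝ) ≤ (⌈K⌉ : ℝ) := by linarith [Int.le_ceil K]
        exact_mod_cast h4
  have key := eq_of_forall_mFourierCoeff_eq (hW.continuous.sub hP.continuous) hsum.continuous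
    (fun k => by
      rw [mFourierCoeff_sub hW.integrable hP.integrable, mFourierCoeff_multiplier_highSymbol hW i K k,
        mFourierCoeff_finset_sum M (fun m _ => (hf m).integrable)]
      simp_rw [mFourierCoeff_multiplier_fibreSymbol hW i]
      rw [← Finset.sum_mul, Finset.sum_ite_eq M (k i) (fun _ => (1 : ℂ))]
      by_cases hk : K ≤ |((k i : ℤ) : ℝ)|
      · rw [if_pos hk, if_neg (by rw [hmem]; exact not_lt.mpr hk)]; ring
      · rw [if_neg hk, if_pos (by rw [hmem]; exact not_le.mp hk)]; ring)
  exact congrFun key x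

end Projections

/-! ## Part 2 — the transport term is skew on streamwise blocks -/

/-- `∂ᵢ` of a fibre translates like the fibre, so `β ∂ᵢ P_{kᵢ=m}W` (with `β` axis-invariant) is an
eigenfunction of the axis translations with character `e_m`; hence its coefficients live on the fibre
`kᵢ = m`. [cite: Grafakos2014, Prop. 3.1.2 (5)] -/
theorem mFourierCoeff_mul_partialDeriv_fibre_eq_zero {W : UnitAddTorus d → ℂ} (hW : IsSmooth W) (i : d)
    {β : UnitAddTorus d → ℝ} (hβ : ∀ (s : UnitAddCircle) (x : UnitAddTorus d), β (x + Pi.single i s) = β x)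
    (m : ℤ) {k : d → ℤ} (hk : k i ≠ m) :
    mFourierCoeff (fun x => (β x : ℂ) * partialDeriv i (Torus.multiplier (fibreSymbol i m) W) x) k = 0 := by
  set f := Torus.multiplier (fibreSymbol i m) W with hf_def
  have hf : IsSmooth f := hW.multiplier (hasPolyGrowth_fibreSymbol i m)
  refine mFourierCoeff_eq_zero_of_forall_add_single_eq_fourier_mul (fun s x => ?_) hk
  have htr : partialDeriv i f (x + Pi.single i s) = fourier m s * partialDeriv i f x := by
    rw [partialDeriv_apply_add]
    have h1 : (fun y => f (y + Pi.single i s)) = fun y => fourier m s * f y :=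
      funext fun y => multiplier_fibreSymbol_add_single hW i m s y
    rw [h1]
    exact ((hf.hasDerivAt_line_zero i x).const_mul (fourier m s : ℂ)).deriv
  rw [hβ, htr]
  ring

/-- `Re (W̄ · β ∂ᵢW) = ½ β ∂ᵢ|W|²` integrates to zero over `T^d` when `∂ᵢβ = 0`: the diagonal part of
the transport pairing on a block is skew. [cite: Evans2010, App. C.2 Thm. 1 (no boundary terms on the torus)] -/
theorem re_integral_conj_mul_mul_partialDeriv_eq_zero {V : UnitAddTorus d → ℂ} (hV : IsSmooth V) (i : d)
    {β : UnitAddTorus d → ℝ} (hβs : IsSmooth β)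
    (hβ : ∀ (s : UnitAddCircle) (x : UnitAddTorus d), β (x + Pi.single i s) = β x) :
    (∫ x, conj (V x) * ((β x : ℂ) * partialDeriv i V x)).re = 0 := by
  -- `N = |V|²` is smooth with `∂ᵢN = 2 Re(V̄ ∂ᵢV)`
  set N : UnitAddTorus d → ℝ := fun x => ‖V x‖ ^ 2 with hN
  have hNs : IsSmooth N := hV.norm_sq
  have hdN : ∀ x, partialDeriv i N x = 2 * (conj (V x) * partialDeriv i V x).re := by
    intro x
    have hline := (hV.hasDerivAt_line_zero i x).norm_sq
    have heq : (fun t : ℝ => ‖V (x + proj (t • EuclideanSpace.single i (1 : ℝ)))‖ ^ 2) =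
        fun t : ℝ => N (x + proj (t • EuclideanSpace.single i (1 : ℝ))) := rfl
    rw [partialDeriv, Torus.lineDeriv]
    rw [show (fun t : ℝ => N (x + proj (t • EuclideanSpace.single i (1 : ℝ)))) =
      (‖(fun t : ℝ => V (x + proj (t • EuclideanSpace.single i (1 : ℝ)))) ·‖ ^ 2) from rfl]
    rw [hline.deriv, real_inner_eq_re_inner ℂ, RCLike.inner_apply']
    simp
  -- `Re ∫ V̄ β ∂ᵢV = ∫ β · ½ ∂ᵢN = ½ ∫ ∂ᵢ(β N) = 0`
  have hint : Integrable (fun x => conj (V x) * ((β x : ℂ) * partialDeriv i V x)) volume :=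
    ((hV.continuous.star).mul ((continuous_ofReal.comp hβs.continuous).mul
      (hV.partialDeriv i).continuous)).integrable_unitAddTorus
  have hre : (∫ x, conj (V x) * ((β x : ℂ) * partialDeriv i V x)).re =
      ∫ x, (conj (V x) * ((β x : ℂ) * partialDeriv i V x)).re := by
    have := integral_re hint
    simp only [RCLike.re_to_complex] at this
    exact this.symm
  rw [hre]
  have hpt : (fun x => (conj (V x) * ((β x : ℂ) * partialDeriv i V x)).re) =
      fun x => (1 / 2 : ℝ) * partialDeriv i (fun y => β y * N y) x := by
    funext x
    rw [partialDeriv_mul (hβs.isContDiff (by simp)) (hNs.isContDiff (by simp)),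
      partialDeriv_eq_zero_of_forall_add_single hβ, zero_mul, add_zero, hdN x]
    have : conj (V x) * ((β x : ℂ) * partialDeriv i V x) = (β x : ℂ) * (conj (V x) * partialDeriv i V x) := by
      ring
    rw [this, Complex.re_ofReal_mul]
    ring
  rw [hpt, integral_const_mul,
    integral_partialDeriv_eq_zero_holds (show IsSmooth (fun y => β y * N y) from hβs.mul hNs) i, mul_zero]

omit [DecidableEq d] in
/-- Polarised Parseval for continuous functions in the tree's global-`volume` convention:
`∑_k conj(𝓕f(k)) 𝓕g(k) = ∫ conj(f) g` (Mathlib `UnitAddTorus.hasSum_prod_mFourierCoeff` for the `L²`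
classes). [cite: Grafakos2014, Prop. 3.2.7 (3)] -/
theorem hasSum_conj_mFourierCoeff_mul_of_continuous {f g : UnitAddTorus d → ℂ} (hf : Continuous f)
    (hg : Continuous g) :
    HasSum (fun k => conj (mFourierCoeff f k) * mFourierCoeff g k) (∫ x, conj (f x) * g x) := by
  set μ : Measure (UnitAddTorus d) := Measure.pi fun _ : d => AddCircle.haarAddCircle with hμ_def
  have hμ : (volume : Measure (UnitAddTorus d)) = μ := volume_eq_pi_haarAddCircle
  haveI : IsProbabilityMeasure μ := hμ ▸ inferInstance
  let Fc : C(UnitAddTorus d, ℂ) := ⟨f, hf⟩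
  let Gc : C(UnitAddTorus d, ℂ) := ⟨g, hg⟩
  have key := UnitAddTorus.hasSum_prod_mFourierCoeff (Fc.toLp 2 μ ℂ) (Gc.toLp 2 μ ℂ)
  have hcf : ∀ k, mFourierCoeff (Fc.toLp 2 μ ℂ) k = mFourierCoeff f k := fun k =>
    UnitAddTorus.mFourierCoeff_toLp Fc k
  have hcg : ∀ k, mFourierCoeff (Gc.toLp 2 μ ℂ) k = mFourierCoeff g k := fun k =>
    UnitAddTorus.mFourierCoeff_toLp Gc k
  have hint : ∫ x, conj ((Fc.toLp 2 μ ℂ) x) * (Gc.toLp 2 μ ℂ) x ∂μ = ∫ x, conj (f x) * g x := by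
    rw [hμ]
    refine integral_congr_ae ?_
    filter_upwards [Fc.coeFn_toLp (p := 2) (μ := μ) (𝕜 := ℂ), Gc.coeFn_toLp (p := 2) (μ := μ) (𝕜 := ℂ)]
      with x hx hy
    rw [hx, hy]
    rfl
  simp_rw [hcf, hcg] at key
  convert key using 1
  rw [← hint]
  rfl

/-- **The transport term is skew on every streamwise block.** For smooth complex `W` on `T^d`, a
smooth real `β` invariant under the translations along the `i`-th axis, and every `K`,
`Re ∑_{k : K ≤ |kᵢ|} conj(𝓕W(k)) 𝓕(β ∂ᵢ W)(k) = 0`.  (The block projection `V = P_{≥K}W` gives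
`∑ = ∫ V̄ β ∂ᵢW`; `W - V` is a finite sum of fibres whose images under `β ∂ᵢ` have no coefficients on the
block; and `Re ∫ V̄ β ∂ᵢV = 0`.)
[cite: BedrossianCotiZelati2017, §1 (decoupling of the streamwise frequencies for shear flows)] -/
theorem re_tsum_conj_mFourierCoeff_mul_shear_eq_zero {W : UnitAddTorus d → ℂ} (hW : IsSmooth W) (i : d)
    {β : UnitAddTorus d → ℝ} (hβs : IsSmooth β)
    (hβ : ∀ (s : UnitAddCircle) (x : UnitAddTorus d), β (x + Pi.single i s) = β x) (K : ℝ) :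
    (∑' k : d → ℤ, if K ≤ |((k i : ℤ) : ℝ)| then
        conj (mFourierCoeff W k) * mFourierCoeff (fun x => (β x : ℂ) * partialDeriv i W x) k else 0).re = 0 := by
  set V := Torus.multiplier (highSymbol i K) W with hV_def
  have hV : IsSmooth V := hW.multiplier (hasPolyGrowth_highSymbol i K)
  set G : UnitAddTorus d → ℂ := fun x => (β x : ℂ) * partialDeriv i W x with hG_def
  have hβc : Continuous fun x => (β x : ℂ) := continuous_ofReal.comp hβs.continuous
  have hG : Continuous G := hβc.mul (hW.partialDeriv i).continuous
  -- the block sum is the pairing `∫ V̄ G`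
  have hpar := hasSum_conj_mFourierCoeff_mul_of_continuous hV.continuous hG
  have hterm : ∀ k, conj (mFourierCoeff V k) * mFourierCoeff G k =
      if K ≤ |((k i : ℤ) : ℝ)| then conj (mFourierCoeff W k) * mFourierCoeff G k else 0 := by
    intro k
    rw [hV_def, mFourierCoeff_multiplier_highSymbol hW i K k]
    split_ifs <;> simp
  simp_rw [hterm] at hpar
  rw [hpar.tsum_eq]
  -- split `G = β ∂ᵢV + β ∂ᵢR`, `R = W - V` a finite sum of fibres
  set M := (Finset.Icc (-⌈K⌉) ⌈K⌉).filter (fun m : ℤ => |((m : ℤ) : ℝ)| < K) with hM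
  have hf : ∀ m, IsSmooth (Torus.multiplier (fibreSymbol i m) W) := fun m =>
    hW.multiplier (hasPolyGrowth_fibreSymbol i m)
  have hR : ∀ x, partialDeriv i W x = partialDeriv i V x +
      ∑ m ∈ M, partialDeriv i (Torus.multiplier (fibreSymbol i m) W) x := by
    intro x
    have hWV : W = V + fun y => ∑ m ∈ M, Torus.multiplier (fibreSymbol i m) W y := by
      funext y
      have := sub_multiplier_highSymbol_eq_sum hW i K y
      simp only [Pi.add_apply]
      rw [← this]; ring
    have hsumC : IsContDiff 1 (fun y => ∑ m ∈ M, Torus.multiplier (fibreSymbol i m) W y) := by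
      have hl : lift (fun y => ∑ m ∈ M, Torus.multiplier (fibreSymbol i m) W y) =
          fun z => ∑ m ∈ M, lift (Torus.multiplier (fibreSymbol i m) W) z := rfl
      unfold IsContDiff; rw [hl]
      exact ContDiff.sum fun m _ => (hf m).isContDiff (n := 1) (by simp)
    conv_lhs => rw [hWV]
    rw [partialDeriv_add (hV.isContDiff (by simp)) hsumC, Pi.add_apply,
      partialDeriv_finset_sum M (fun m _ => (hf m).isContDiff (by simp))]
  have hGsplit : G = fun x => conj (1 : ℂ) * ((β x : ℂ) * partialDeriv i V x) +
      ∑ m ∈ M, (β x : ℂ) * partialDeriv i (Torus.multiplier (fibreSymbol i m) W) x := by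
    funext x
    rw [hG_def]
    simp only [map_one, one_mul]
    rw [hR x, mul_add, Finset.mul_sum]
  -- the fibre part pairs to zero with `V`, coefficient by coefficient
  have hfib : ∀ k, conj (mFourierCoeff V k) *
      mFourierCoeff (fun x => ∑ m ∈ M, (β x : ℂ) * partialDeriv i (Torus.multiplier (fibreSymbol i m) W) x) k = 0 := by
    intro k
    by_cases hk : K ≤ |((k i : ℤ) : ℝ)|
    · have hsum0 : mFourierCoeff (fun x => ∑ m ∈ M,
          (β x : ℂ) * partialDeriv i (Torus.multiplier (fibreSymbol i m) W) x) k = 0 := by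
        rw [mFourierCoeff_finset_sum M
          (f := fun m x => (β x : ℂ) * partialDeriv i (Torus.multiplier (fibreSymbol i m) W) x)
          (fun m _ => (hβc.mul ((hf m).partialDeriv i).continuous).integrable_unitAddTorus)]
        refine Finset.sum_eq_zero (fun m hm => ?_)
        refine mFourierCoeff_mul_partialDeriv_fibre_eq_zero hW i hβ m (fun hkm => ?_)
        have hm' : |((m : ℤ) : ℝ)| < K := (Finset.mem_filter.mp hm).2
        rw [← hkm] at hm'
        exact absurd hk (not_le.mpr hm')
      rw [hsum0, mul_zero]
    · rw [hV_def, mFourierCoeff_multiplier_highSymbol hW i K k, if_neg hk]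
      simp
  have h1 : Integrable (fun x => conj (V x) * ((β x : ℂ) * partialDeriv i V x)) volume :=
    ((hV.continuous.star).mul (hβc.mul (hV.partialDeriv i).continuous)).integrable_unitAddTorus
  have hS : Continuous fun x => ∑ m ∈ M, (β x : ℂ) * partialDeriv i (Torus.multiplier (fibreSymbol i m) W) x :=
    continuous_finsetSum M fun m _ => hβc.mul ((hf m).partialDeriv i).continuous
  have h2 : Integrable (fun x => conj (V x) *
      ∑ m ∈ M, (β x : ℂ) * partialDeriv i (Torus.multiplier (fibreSymbol i m) W) x) volume :=
    ((hV.continuous.star).mul hS).integrable_unitAddTorus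
  have hpar2 := hasSum_conj_mFourierCoeff_mul_of_continuous hV.continuous hS
  simp_rw [hfib] at hpar2
  have hzero : ∫ x, conj (V x) *
      ∑ m ∈ M, (β x : ℂ) * partialDeriv i (Torus.multiplier (fibreSymbol i m) W) x = 0 := by
    rw [← hpar2.tsum_eq, tsum_zero]
  rw [hGsplit]
  simp only [map_one, one_mul]
  simp_rw [mul_add]
  rw [integral_add h1 h2, hzero, add_zero]
  exact re_integral_conj_mul_mul_partialDeriv_eq_zero hV i hβs hβ


/-! ## Part 3 — the coefficient equation of a classical solution and finite-block bookkeeping -/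

section Coefficients

variable {S : Set ℝ} {φ : ℝ → UnitAddTorus d → ℝ}

omit [DecidableEq d] in
/-- Fourier coefficients of the slices of a jointly smooth scalar field, as integrals against a
fixed smooth field. [folklore] -/
private theorem mFourierCoeff_slice_eq_integral (φ : ℝ → UnitAddTorus d → ℝ) (k : d → ℤ) (s : ℝ) :
    mFourierCoeff (fun x => (φ s x : ℂ)) k = ∫ x, φ s x • (mFourier (-k) x : ℂ) := by
  rw [mFourierCoeff_eq_integral_volume]
  congr 1; funext x
  rw [Complex.real_smul, smul_eq_mul, mul_comm]

omit [DecidableEq d] in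
/-- **The coefficients are differentiable in time within the time set**, with derivative the
coefficient of `∂ₜφ` (differentiation under `∫_{T^d}`, `IsSmoothSpaceTimeOn.hasDerivWithinAt_integral`).
[folklore] -/
private theorem hasDerivWithinAt_mFourierCoeff_slice (hφ : IsSmoothSpaceTimeOn S φ) (hS : Convex ℝ S)
    (hU : UniqueDiffOn ℝ S) {t : ℝ} (ht : t ∈ S) (k : d → ℤ) :
    HasDerivWithinAt (fun s => mFourierCoeff (fun x => (φ s x : ℂ)) k)
      (mFourierCoeff (fun x => ((timeDerivWithin S φ t x : ℝ) : ℂ)) k) S t := by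
  set ψ : ℝ → UnitAddTorus d → ℂ := fun s x => φ s x • (mFourier (-k) x : ℂ) with hψ_def
  have hψ : IsSmoothSpaceTimeOn S ψ := hφ.smul (isSmoothSpaceTimeOn_const (isSmooth_mFourier (-k)) S)
  have hD := hψ.hasDerivWithinAt_integral hS ht
  have hψ' : ∀ x, timeDerivWithin S ψ t x = timeDerivWithin S φ t x • (mFourier (-k) x : ℂ) := fun x =>
    ((hφ.hasDerivWithinAt_slice ht x).smul_const (mFourier (-k) x : ℂ)).derivWithin (hU t ht)
  have e1 : (fun s => mFourierCoeff (fun x => (φ s x : ℂ)) k) = fun s => ∫ x, ψ s x :=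
    funext fun s => mFourierCoeff_slice_eq_integral φ k s
  have e2 : mFourierCoeff (fun x => ((timeDerivWithin S φ t x : ℝ) : ℂ)) k = ∫ x, timeDerivWithin S ψ t x := by
    rw [mFourierCoeff_slice_eq_integral]
    exact integral_congr_ae (ae_of_all _ fun x => (hψ' x).symm)
  rw [e1, e2]
  exact hD

omit [DecidableEq d] in
/-- The coefficients of the slices depend continuously on time (convex time set). [folklore] -/
private theorem continuousOn_mFourierCoeff_slice (hφ : IsSmoothSpaceTimeOn S φ) (hS : Convex ℝ S) (k : d → ℤ) :
    ContinuousOn (fun s => mFourierCoeff (fun x => (φ s x : ℂ)) k) S := by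
  have hψ : IsSmoothSpaceTimeOn S (fun s x => φ s x • (mFourier (-k) x : ℂ)) :=
    hφ.smul (isSmoothSpaceTimeOn_const (isSmooth_mFourier (-k)) S)
  refine (hψ.continuousOn_integral hS).congr fun s _ => ?_
  exact mFourierCoeff_slice_eq_integral φ k s

omit [DecidableEq d] in
/-- Uniform `L²` control of the coefficients on compact time sets: `∑_{k∈A} ‖𝓕(φ(t))(k)‖² ≤ C²`
whenever `|φ| ≤ C` on `S × T^d` (Bessel/Parseval and `vol(T^d) = 1`). [folklore] -/
private theorem sum_sq_norm_mFourierCoeff_slice_le (hφ : IsSmoothSpaceTimeOn S φ) {C : ℝ}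
    (hC : ∀ t ∈ S, ∀ x, ‖φ t x‖ ≤ C) {t : ℝ} (ht : t ∈ S) (A : Finset (d → ℤ)) :
    ∑ k ∈ A, ‖mFourierCoeff (fun x => (φ t x : ℂ)) k‖ ^ 2 ≤ C ^ 2 := by
  have hc : Continuous fun x => (φ t x : ℂ) := continuous_ofReal.comp (hφ.isSmooth_slice ht).continuous
  have hP := hasSum_sq_mFourierCoeff_of_continuous hc
  refine (sum_le_hasSum A (fun k _ => sq_nonneg _) hP).trans ?_
  have h0 : 0 ≤ C := (norm_nonneg _).trans (hC t ht 0)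
  calc ∫ x, ‖(φ t x : ℂ)‖ ^ 2 ≤ ∫ _x : UnitAddTorus d, C ^ 2 := by
        refine integral_mono ((hc.norm.pow 2).integrable_unitAddTorus) (integrable_const _) fun x => ?_
        have h1 : ‖(φ t x : ℂ)‖ = ‖φ t x‖ := by rw [Complex.norm_real]
        rw [h1]
        exact pow_le_pow_left₀ (norm_nonneg _) (hC t ht x) 2
    _ = C ^ 2 := by simp

end Coefficients

section Classical

variable {t₀ t₁ κ : ℝ} {u : ℝ → UnitAddTorus d → EuclideanSpace ℝ d} {w : ℝ → UnitAddTorus d → ℝ}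

omit [DecidableEq d] in
/-- `⟪eᵢ-shear, ∇θ⟫ = b ∂ᵢθ`: the advection term of a shear along the `i`-th axis. [folklore] -/
private theorem inner_gradient_of_shear [DecidableEq d] {θ : UnitAddTorus d → ℝ} (hθ : IsSmooth θ) (i : d)
    {v : EuclideanSpace ℝ d} (hv : v = v i • EuclideanSpace.single i (1 : ℝ)) (x : UnitAddTorus d) :
    ⟪v, Torus.gradient θ x⟫_ℝ = v i * partialDeriv i θ x := by
  rw [hv, real_inner_smul_left, EuclideanSpace.inner_single_left, gradient_apply (hθ.isContDiff (by simp))]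
  simp

/-- **The coefficient equation.** For a classical solution on `[t₀, t₁]`:
`𝓕(∂ₜw(t))(k) = -𝓕(⟪u, ∇w⟫(t))(k) - 4π²κ|k|² 𝓕(w(t))(k)`. [cite: DEIJ2022, (1.1)] -/
theorem mFourierCoeff_timeDerivWithin_eq (h : IsClassicalScalarTransportOn (Icc t₀ t₁) κ u w)
    {t : ℝ} (ht : t ∈ Icc t₀ t₁) (k : d → ℤ) :
    mFourierCoeff (fun x => ((timeDerivWithin (Icc t₀ t₁) w t x : ℝ) : ℂ)) k =
      -mFourierCoeff (fun x => (⟪u t x, Torus.gradient (w t) x⟫_ℝ : ℂ)) k -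
        ((4 * Real.pi ^ 2 * κ * freqNormSq k : ℝ) : ℂ) * mFourierCoeff (fun x => (w t x : ℂ)) k := by
  have hwt : IsSmooth (w t) := h.smooth_scalar.isSmooth_slice ht
  have hut : IsSmooth (u t) := h.smooth_velocity.isSmooth_slice ht
  have hWt : IsSmooth (fun x => (w t x : ℂ)) := hwt.ofReal
  have hpt : (fun x => ((timeDerivWithin (Icc t₀ t₁) w t x : ℝ) : ℂ)) =
      (fun x => κ • Torus.laplacian (fun y => (w t y : ℂ)) x) - fun x => (⟪u t x, Torus.gradient (w t) x⟫_ℝ : ℂ) := by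
    funext x
    simp only [Pi.sub_apply]
    have hr : timeDerivWithin (Icc t₀ t₁) w t x =
        κ * Torus.laplacian (w t) x - ⟪u t x, Torus.gradient (w t) x⟫_ℝ := by
      linarith [h.transport t ht x]
    rw [hr, ← ofReal_laplacian hwt, Complex.real_smul]
    push_cast
    ring
  have i1 : Integrable (fun x => κ • Torus.laplacian (fun y => (w t y : ℂ)) x) volume :=
    (hWt.laplacian.integrable).smul κ
  have i2 : Integrable (fun x => (⟪u t x, Torus.gradient (w t) x⟫_ℝ : ℂ)) volume :=
    (hut.inner hwt.gradient).ofReal.integrable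
  rw [hpt, mFourierCoeff_sub i1 i2, mFourierCoeff_real_smul, mFourierCoeff_laplacian_complex hWt]
  push_cast
  ring

/-- `2⟪c, ċ⟫_ℝ` for a coefficient `c = 𝓕(w(t))(k)` of a classical solution:
`= -2 Re(c̄ 𝓕(⟪u,∇w⟫)(k)) - 8π²κ|k|² ‖c‖²`. [cite: DEIJ2022, (1.2)] -/
theorem two_inner_mFourierCoeff_timeDerivWithin (h : IsClassicalScalarTransportOn (Icc t₀ t₁) κ u w)
    {t : ℝ} (ht : t ∈ Icc t₀ t₁) (k : d → ℤ) :
    2 * ⟪mFourierCoeff (fun x => (w t x : ℂ)) k,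
        mFourierCoeff (fun x => ((timeDerivWithin (Icc t₀ t₁) w t x : ℝ) : ℂ)) k⟫_ℝ =
      -2 * (conj (mFourierCoeff (fun x => (w t x : ℂ)) k) *
          mFourierCoeff (fun x => (⟪u t x, Torus.gradient (w t) x⟫_ℝ : ℂ)) k).re -
        8 * Real.pi ^ 2 * κ * freqNormSq k * ‖mFourierCoeff (fun x => (w t x : ℂ)) k‖ ^ 2 := by
  rw [mFourierCoeff_timeDerivWithin_eq h ht k, real_inner_eq_re_inner ℂ, RCLike.inner_apply']
  set c := mFourierCoeff (fun x => (w t x : ℂ)) k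
  set f := mFourierCoeff (fun x => (⟪u t x, Torus.gradient (w t) x⟫_ℝ : ℂ)) k
  have hcc : conj c * c = ((‖c‖ ^ 2 : ℝ) : ℂ) := by
    rw [mul_comm, Complex.mul_conj, Complex.normSq_eq_norm_sq]
  have : conj c * (-f - ((4 * Real.pi ^ 2 * κ * freqNormSq k : ℝ) : ℂ) * c) =
      -(conj c * f) - ((4 * Real.pi ^ 2 * κ * freqNormSq k : ℝ) : ℂ) * ((‖c‖ ^ 2 : ℝ) : ℂ) := by
    rw [← hcc]; ring
  rw [RCLike.re_to_complex, this, Complex.sub_re, Complex.neg_re, ← Complex.ofReal_mul, Complex.ofReal_re]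
  ring

/-- **Exact energy bookkeeping for a FINITE block of modes** (fundamental theorem of calculus for
`t ↦ e^{λt} ∑_{k∈A} |c_k(t)|²` on `[t₀, t₁]`). [cite: DEIJ2022, (1.2)–(1.3)] -/
theorem exp_mul_sum_sq_sub_eq_integral (h : IsClassicalScalarTransportOn (Icc t₀ t₁) κ u w)
    (hlt : t₀ < t₁) (A : Finset (d → ℤ)) (lam : ℝ) :
    Real.exp (lam * t₁) * ∑ k ∈ A, ‖mFourierCoeff (fun x => (w t₁ x : ℂ)) k‖ ^ 2 -
        Real.exp (lam * t₀) * ∑ k ∈ A, ‖mFourierCoeff (fun x => (w t₀ x : ℂ)) k‖ ^ 2 =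
      ∫ t in t₀..t₁, Real.exp (lam * t) *
        (lam * ∑ k ∈ A, ‖mFourierCoeff (fun x => (w t x : ℂ)) k‖ ^ 2 -
          8 * Real.pi ^ 2 * κ * ∑ k ∈ A, freqNormSq k * ‖mFourierCoeff (fun x => (w t x : ℂ)) k‖ ^ 2 -
          2 * ∑ k ∈ A, (conj (mFourierCoeff (fun x => (w t x : ℂ)) k) *
            mFourierCoeff (fun x => (⟪u t x, Torus.gradient (w t) x⟫_ℝ : ℂ)) k).re) := by
  set S := Icc t₀ t₁ with hS_def
  have hS : Convex ℝ S := convex_Icc t₀ t₁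
  have hU : UniqueDiffOn ℝ S := uniqueDiffOn_Icc hlt
  have hws := h.smooth_scalar
  set c : (d → ℤ) → ℝ → ℂ := fun k t => mFourierCoeff (fun x => (w t x : ℂ)) k with hc_def
  set c' : (d → ℤ) → ℝ → ℂ := fun k t => mFourierCoeff (fun x => ((timeDerivWithin S w t x : ℝ) : ℂ)) k with hc'_def
  set f : (d → ℤ) → ℝ → ℂ := fun k t =>
    mFourierCoeff (fun x => (⟪u t x, Torus.gradient (w t) x⟫_ℝ : ℂ)) k with hf_def
  -- derivative of the weighted block energy within `S`
  set g : ℝ → ℝ := fun t => Real.exp (lam * t) * ∑ k ∈ A, ‖c k t‖ ^ 2 with hg_def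
  set g' : ℝ → ℝ := fun t => Real.exp (lam * t) *
    (lam * ∑ k ∈ A, ‖c k t‖ ^ 2 - 8 * Real.pi ^ 2 * κ * ∑ k ∈ A, freqNormSq k * ‖c k t‖ ^ 2 -
      2 * ∑ k ∈ A, (conj (c k t) * f k t).re) with hg'_def
  have hderiv : ∀ t ∈ S, HasDerivWithinAt g (g' t) S t := by
    intro t ht
    have hE : HasDerivWithinAt (fun s => ∑ k ∈ A, ‖c k s‖ ^ 2)
        (∑ k ∈ A, 2 * ⟪c k t, c' k t⟫_ℝ) S t := by
      have := HasDerivWithinAt.fun_sum (u := A) (A := fun k s => ‖c k s‖ ^ 2)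
        (A' := fun k => 2 * ⟪c k t, c' k t⟫_ℝ) (fun k _ =>
          (hasDerivWithinAt_mFourierCoeff_slice hws hS hU ht k).norm_sq)
      exact this
    have hexp : HasDerivWithinAt (fun s => Real.exp (lam * s)) (Real.exp (lam * t) * lam) S t :=
      ((hasDerivAt_id t).const_mul lam |>.exp).hasDerivWithinAt |>.congr_deriv (by simp)
    have hprod := hexp.mul hE
    refine hprod.congr_deriv ?_
    rw [hg'_def]
    simp only
    have hsum : ∑ k ∈ A, 2 * ⟪c k t, c' k t⟫_ℝ =
        -2 * ∑ k ∈ A, (conj (c k t) * f k t).re - 8 * Real.pi ^ 2 * κ * ∑ k ∈ A, freqNormSq k * ‖c k t‖ ^ 2 := by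
      rw [Finset.mul_sum, Finset.mul_sum, ← Finset.sum_sub_distrib]
      refine Finset.sum_congr rfl fun k _ => ?_
      rw [hc_def, hc'_def, hf_def]
      simp only
      rw [two_inner_mFourierCoeff_timeDerivWithin h ht k]
      ring
    rw [hsum]
    ring
  -- continuity of the derivative on `S`
  have hcont_c : ∀ k, ContinuousOn (c k) S := fun k => continuousOn_mFourierCoeff_slice hws hS k
  have hFs : IsSmoothSpaceTimeOn S (fun t x => ⟪u t x, Torus.gradient (w t) x⟫_ℝ) :=
    h.smooth_velocity.inner (hws.gradient hU)
  have hcont_f : ∀ k, ContinuousOn (f k) S := fun k => continuousOn_mFourierCoeff_slice hFs hS k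
  have hcont_g' : ContinuousOn g' S := by
    refine (Real.continuous_exp.comp_continuousOn ((continuousOn_const).mul continuousOn_id)).mul ?_
    refine ((continuousOn_const.mul (continuousOn_finsetSum A fun k _ => (hcont_c k).norm.pow 2)).sub
      (continuousOn_const.mul (continuousOn_finsetSum A fun k _ =>
        continuousOn_const.mul ((hcont_c k).norm.pow 2)))).sub
      (continuousOn_const.mul (continuousOn_finsetSum A fun k _ => ?_))
    exact Complex.continuous_re.comp_continuousOn (((hcont_c k).star).mul (hcont_f k))
  have hFTC : ∫ τ in t₀..t₁, g' τ = g t₁ - g t₀ :=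
    intervalIntegral.integral_eq_sub_of_hasDerivAt_of_le hlt.le
      (fun τ hτ => (hderiv τ hτ).continuousWithinAt)
      (fun τ hτ => (hderiv τ (Ioo_subset_Icc_self hτ)).hasDerivAt (Icc_mem_nhds hτ.1 hτ.2))
      ((hcont_g'.mono (uIcc_of_le hlt.le).subset).intervalIntegrable)
  rw [hg_def, hg'_def] at hFTC
  simp only at hFTC
  rw [hFTC]

/-- The diffusion term of a finite block is dominated by the dissipation:
`4π² ∑_{k∈A} |k|² |c_k(t)|² ≤ ‖∇w(t)‖²_{L²}`. [cite: Grafakos2014, Prop. 3.2.7 (3)] -/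
theorem four_pi_sq_mul_sum_freqNormSq_mul_le_scalarGradNormSq {θ : UnitAddTorus d → ℝ} (hθ : IsSmooth θ)
    (A : Finset (d → ℤ)) :
    4 * Real.pi ^ 2 * ∑ k ∈ A, freqNormSq k * ‖mFourierCoeff (fun x => (θ x : ℂ)) k‖ ^ 2 ≤
      scalarGradNormSq θ := by
  have hΘ : IsSmooth (fun x => (θ x : ℂ)) := hθ.ofReal
  -- Parseval for each `∂ⱼ θ`
  have hj : ∀ j : d, HasSum (fun k : d → ℤ =>
      4 * Real.pi ^ 2 * ((k j : ℝ) ^ 2 * ‖mFourierCoeff (fun x => (θ x : ℂ)) k‖ ^ 2))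
      (∫ x, partialDeriv j θ x ^ 2) := by
    intro j
    have hP := hasSum_sq_mFourierCoeff_of_continuous (hΘ.partialDeriv j).continuous
    have h1 : (fun k => ‖mFourierCoeff (partialDeriv j fun x => (θ x : ℂ)) k‖ ^ 2) =
        fun k : d → ℤ => 4 * Real.pi ^ 2 * ((k j : ℝ) ^ 2 * ‖mFourierCoeff (fun x => (θ x : ℂ)) k‖ ^ 2) := by
      funext k
      rw [mFourierCoeff_partialDeriv hΘ j k, norm_smul, mul_pow]
      have : ‖(2 * Real.pi * Complex.I * (k j : ℂ))‖ ^ 2 = 4 * Real.pi ^ 2 * (k j : ℝ) ^ 2 := by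
        rw [norm_mul, norm_mul, norm_mul, Complex.norm_I, mul_one, Complex.norm_real, Complex.norm_intCast,
          Complex.norm_ofNat, Real.norm_eq_abs, abs_of_pos Real.pi_pos]
        rw [mul_pow, mul_pow, sq_abs]; ring
      rw [this]; ring
    have h2 : (∫ x, ‖partialDeriv j (fun x => (θ x : ℂ)) x‖ ^ 2) = ∫ x, partialDeriv j θ x ^ 2 := by
      congr 1; funext x
      rw [partialDeriv_ofReal_comp hθ, Complex.norm_real, Real.norm_eq_abs, sq_abs]
    rw [h1, h2] at hP
    exact hP
  have hsum := hasSum_sum (s := Finset.univ) fun j _ => hj j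
  have hlhs : (fun k : d → ℤ => ∑ j : d, 4 * Real.pi ^ 2 * ((k j : ℝ) ^ 2 * ‖mFourierCoeff (fun x => (θ x : ℂ)) k‖ ^ 2)) =
      fun k => 4 * Real.pi ^ 2 * (freqNormSq k * ‖mFourierCoeff (fun x => (θ x : ℂ)) k‖ ^ 2) := by
    funext k
    rw [freqNormSq, Finset.sum_mul, Finset.mul_sum]
  rw [hlhs, ← scalarGradNormSq_eq_sum_integral hθ] at hsum
  have hle := sum_le_hasSum A (fun k _ => by
    have := freqNormSq_nonneg k; positivity) hsum
  rw [← Finset.mul_sum] at hle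
  exact hle

end Classical


/-! ## Part 4 — passage to the infinite block and the damping theorems -/

section Main

variable {t₀ t₁ κ : ℝ} {u : ℝ → UnitAddTorus d → EuclideanSpace ℝ d} {w : ℝ → UnitAddTorus d → ℝ}

omit [Fintype d] [DecidableEq d] in
/-- `‖z̄ v‖ ≤ ‖z‖² + ‖v‖²`. [folklore] -/
private theorem norm_conj_mul_le_sq_add_sq (z v : ℂ) : ‖conj z * v‖ ≤ ‖z‖ ^ 2 + ‖v‖ ^ 2 := by
  rw [norm_mul, RCLike.norm_conj]
  nlinarith [sq_nonneg (‖z‖ - ‖v‖), norm_nonneg z, norm_nonneg v]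

omit [DecidableEq d] in
/-- The indicator of a summable nonnegative real series is summable with the obvious `HasSum`. [folklore] -/
private theorem hasSum_ite_sq_norm_mFourierCoeff {θ : UnitAddTorus d → ℝ} (hθ : Continuous θ) (p : (d → ℤ) → Prop)
    [DecidablePred p] :
    HasSum (fun k => if p k then ‖mFourierCoeff (fun x => (θ x : ℂ)) k‖ ^ 2 else 0)
      (∑' k, if p k then ‖mFourierCoeff (fun x => (θ x : ℂ)) k‖ ^ 2 else 0) := by
  have hP := hasSum_sq_mFourierCoeff_of_continuous (continuous_ofReal.comp hθ)
  refine (Summable.of_nonneg_of_le (fun k => ?_) (fun k => ?_) hP.summable).hasSum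
  · split_ifs <;> positivity
  · split_ifs
    · exact le_rfl
    · positivity

omit [DecidableEq d] in
/-- `highModeEnergy` of a continuous real scalar is the `ofReal` of the real (summable, by Parseval) block
sum. [cite: Grafakos2014, Prop. 3.2.7 (3) (Parseval)] -/
theorem highModeEnergy_eq_ofReal_tsum {θ : UnitAddTorus d → ℝ} (hθ : Continuous θ) (i : d) (K : ℝ) :
    highModeEnergy i K θ = ENNReal.ofReal
      (∑' k : d → ℤ, if K ≤ |((k i : ℤ) : ℝ)| then ‖mFourierCoeff (fun x => (θ x : ℂ)) k‖ ^ 2 else 0) := by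
  have hS := hasSum_ite_sq_norm_mFourierCoeff hθ (fun k : d → ℤ => K ≤ |((k i : ℤ) : ℝ)|)
  rw [highModeEnergy, ENNReal.ofReal_tsum_of_nonneg (fun k => by split_ifs <;> positivity) hS.summable]
  refine tsum_congr fun k => ?_
  split_ifs
  · rw [← ofReal_norm, ← ENNReal.ofReal_pow (norm_nonneg _)]
  · simp

/-- **Core estimate on `[t₀, t₁]` with `t₀ < t₁`**: the high block decays at the bare rate and the low
block is non-increasing (real form, block sums as `tsum`s). [cite: BedrossianCotiZelati2017, §1] -/
theorem tsum_high_le_and_low_le (h : IsClassicalScalarTransportOn (Icc t₀ t₁) κ u w) (hlt : t₀ < t₁)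
    (hκ : 0 ≤ κ) (i : d)
    (hdir : ∀ t ∈ Icc t₀ t₁, ∀ x, u t x = (u t x i) • EuclideanSpace.single i (1 : ℝ))
    (hinv : ∀ t ∈ Icc t₀ t₁, ∀ (s : UnitAddCircle) (x : UnitAddTorus d), u t (x + Pi.single i s) = u t x)
    {K : ℝ} (hK : 0 ≤ K) :
    (Real.exp (8 * Real.pi ^ 2 * κ * K ^ 2 * t₁) *
        (∑' k : d → ℤ, if K ≤ |((k i : ℤ) : ℝ)| then ‖mFourierCoeff (fun x => (w t₁ x : ℂ)) k‖ ^ 2 else 0) ≤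
      Real.exp (8 * Real.pi ^ 2 * κ * K ^ 2 * t₀) *
        (∑' k : d → ℤ, if K ≤ |((k i : ℤ) : ℝ)| then ‖mFourierCoeff (fun x => (w t₀ x : ℂ)) k‖ ^ 2 else 0)) ∧
    (scalarL2Sq (w t₁) -
        (∑' k : d → ℤ, if K ≤ |((k i : ℤ) : ℝ)| then ‖mFourierCoeff (fun x => (w t₁ x : ℂ)) k‖ ^ 2 else 0) ≤
      scalarL2Sq (w t₀) -
        (∑' k : d → ℤ, if K ≤ |((k i : ℤ) : ℝ)| then ‖mFourierCoeff (fun x => (w t₀ x : ℂ)) k‖ ^ 2 else 0)) := by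
  set S := Icc t₀ t₁ with hS_def
  have hS : Convex ℝ S := convex_Icc t₀ t₁
  have hU : UniqueDiffOn ℝ S := uniqueDiffOn_Icc hlt
  have hws := h.smooth_scalar
  have hFs : IsSmoothSpaceTimeOn S (fun t x => ⟪u t x, Torus.gradient (w t) x⟫_ℝ) :=
    h.smooth_velocity.inner (hws.gradient hU)
  set lam : ℝ := 8 * Real.pi ^ 2 * κ * K ^ 2 with hlam
  set c : (d → ℤ) → ℝ → ℂ := fun k t => mFourierCoeff (fun x => (w t x : ℂ)) k with hc_def
  set f : (d → ℤ) → ℝ → ℂ := fun k t =>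
    mFourierCoeff (fun x => (⟪u t x, Torus.gradient (w t) x⟫_ℝ : ℂ)) k with hf_def
  let χ : (d → ℤ) → Prop := fun k => K ≤ |((k i : ℤ) : ℝ)|
  -- block sums
  set EB : ℝ → ℝ := fun t => ∑' k, if χ k then ‖c k t‖ ^ 2 else 0 with hEB
  set advB : ℝ → ℂ := fun t => ∑' k, if χ k then conj (c k t) * f k t else 0 with hadvB
  have hEsum : ∀ t ∈ S, HasSum (fun k => if χ k then ‖c k t‖ ^ 2 else 0) (EB t) := fun t ht =>
    hasSum_ite_sq_norm_mFourierCoeff (hws.isSmooth_slice ht).continuous χ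
  -- uniform bounds on `S × T^d`
  obtain ⟨Cw, hCw⟩ := hws.exists_norm_le_of_isCompact isCompact_Icc subset_rfl
  obtain ⟨CF, hCF⟩ := hFs.exists_norm_le_of_isCompact isCompact_Icc subset_rfl
  have hsum_c : ∀ t ∈ S, ∀ A : Finset (d → ℤ), ∑ k ∈ A, ‖c k t‖ ^ 2 ≤ Cw ^ 2 := fun t ht A =>
    sum_sq_norm_mFourierCoeff_slice_le hws hCw ht A
  have hsum_f : ∀ t ∈ S, ∀ A : Finset (d → ℤ), ∑ k ∈ A, ‖f k t‖ ^ 2 ≤ CF ^ 2 := fun t ht A =>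
    sum_sq_norm_mFourierCoeff_slice_le hFs hCF ht A
  -- summability of the transport pairing and vanishing of its real part (Part 2)
  have hadv_sum : ∀ t ∈ S, HasSum (fun k => if χ k then conj (c k t) * f k t else 0) (advB t) := by
    intro t ht
    have hPc := hasSum_sq_mFourierCoeff_of_continuous
      (continuous_ofReal.comp (hws.isSmooth_slice ht).continuous)
    have hPf := hasSum_sq_mFourierCoeff_of_continuous
      (continuous_ofReal.comp (hFs.isSmooth_slice ht).continuous)
    refine (Summable.of_norm_bounded (g := fun k => ‖c k t‖ ^ 2 + ‖f k t‖ ^ 2)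
      (hPc.summable.add hPf.summable) (fun k => ?_)).hasSum
    split_ifs
    · exact norm_conj_mul_le_sq_add_sq _ _
    · simp only [norm_zero]; positivity
  have hadv_re : ∀ t ∈ S, (advB t).re = 0 := by
    intro t ht
    have hwt : IsSmooth (w t) := hws.isSmooth_slice ht
    have hut : IsSmooth (u t) := h.smooth_velocity.isSmooth_slice ht
    have hβs : IsSmooth (fun x => u t x i) := hut.apply i
    have hβ : ∀ (s : UnitAddCircle) (x : UnitAddTorus d), u t (x + Pi.single i s) i = u t x i :=
      fun s x => by rw [hinv t ht s x]
    have key := re_tsum_conj_mFourierCoeff_mul_shear_eq_zero hwt.ofReal i hβs hβ K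
    have hfun : (fun x => ((u t x i : ℝ) : ℂ) * partialDeriv i (fun y => (w t y : ℂ)) x) =
        fun x => (⟪u t x, Torus.gradient (w t) x⟫_ℝ : ℂ) := by
      funext x
      rw [partialDeriv_ofReal_comp hwt, inner_gradient_of_shear hwt i (hdir t ht x)]
      push_cast; ring
    rw [hfun] at key
    exact key
  -- the dominated-convergence passage for the transport pairing
  have hDCT : ∀ μ_ : ℝ, Tendsto (fun s : Finset (d → ℤ) => ∫ t in t₀..t₁,
      Real.exp (μ_ * t) * (2 * (∑ k ∈ s, if χ k then conj (c k t) * f k t else 0).re)) atTop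
      (𝓝 0) := by
    intro μ_
    have hlim0 : (∫ t in t₀..t₁, Real.exp (μ_ * t) * (2 * (advB t).re)) = 0 := by
      rw [intervalIntegral.integral_congr (g := fun _ => (0 : ℝ)) (fun t ht => ?_)]
      · simp
      · rw [uIcc_of_le hlt.le] at ht
        simp [hadv_re t ht]
    rw [← hlim0]
    refine intervalIntegral.tendsto_integral_filter_of_dominated_convergence
      (fun _ => Real.exp (|μ_| * (|t₀| + |t₁|)) * (2 * (Cw ^ 2 + CF ^ 2))) ?_ ?_
      intervalIntegrable_const ?_
    · refine Eventually.of_forall fun s => ?_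
      have hcont : ContinuousOn (fun t => Real.exp (μ_ * t) *
          (2 * (∑ k ∈ s, if χ k then conj (c k t) * f k t else 0).re)) S := by
        refine (Real.continuous_exp.comp_continuousOn (continuousOn_const.mul continuousOn_id)).mul
          (continuousOn_const.mul (Complex.continuous_re.comp_continuousOn
            (continuousOn_finsetSum s fun k _ => ?_)))
        split_ifs
        · exact ((continuousOn_mFourierCoeff_slice hws hS k).star).mul
            (continuousOn_mFourierCoeff_slice hFs hS k)
        · exact continuousOn_const
      rw [uIoc_of_le hlt.le]
      exact (hcont.mono Ioc_subset_Icc_self).aestronglyMeasurable measurableSet_Ioc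
    · refine Eventually.of_forall fun s => ae_of_all _ fun t ht => ?_
      rw [uIoc_of_le hlt.le] at ht
      have htS : t ∈ S := Ioc_subset_Icc_self ht
      have h1 : ‖Real.exp (μ_ * t)‖ ≤ Real.exp (|μ_| * (|t₀| + |t₁|)) := by
        rw [Real.norm_eq_abs, abs_of_pos (Real.exp_pos _)]
        refine Real.exp_le_exp.mpr ?_
        have : |t| ≤ |t₀| + |t₁| := by
          rcases le_or_gt 0 t with h0 | h0
          · rw [abs_of_nonneg h0]; linarith [le_abs_self t₁, ht.2, abs_nonneg t₀]
          · rw [abs_of_neg h0]; linarith [neg_le_abs t₀, ht.1, abs_nonneg t₁]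
        calc μ_ * t ≤ |μ_ * t| := le_abs_self _
          _ = |μ_| * |t| := abs_mul _ _
          _ ≤ |μ_| * (|t₀| + |t₁|) := mul_le_mul_of_nonneg_left this (abs_nonneg _)
      have h2 : ‖(2 * (∑ k ∈ s, if χ k then conj (c k t) * f k t else 0).re)‖ ≤ 2 * (Cw ^ 2 + CF ^ 2) := by
        rw [Real.norm_eq_abs, abs_mul, abs_two]
        refine mul_le_mul_of_nonneg_left ?_ (by norm_num)
        refine (Complex.abs_re_le_norm _).trans ((norm_sum_le _ _).trans ?_)
        have hterm : ∀ k ∈ s, ‖(if χ k then conj (c k t) * f k t else 0)‖ ≤ ‖c k t‖ ^ 2 + ‖f k t‖ ^ 2 := by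
          intro k _
          split_ifs
          · exact norm_conj_mul_le_sq_add_sq _ _
          · simp only [norm_zero]; positivity
        refine (Finset.sum_le_sum hterm).trans ?_
        rw [Finset.sum_add_distrib]
        exact add_le_add (hsum_c t htS s) (hsum_f t htS s)
      rw [norm_mul]
      exact mul_le_mul h1 h2 (norm_nonneg _) (Real.exp_pos _).le
    · refine ae_of_all _ fun t ht => ?_
      rw [uIoc_of_le hlt.le] at ht
      have htS : t ∈ S := Ioc_subset_Icc_self ht
      have hT : Tendsto (fun s : Finset (d → ℤ) => ∑ k ∈ s, if χ k then conj (c k t) * f k t else 0)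
          atTop (𝓝 (advB t)) := hadv_sum t htS
      exact ((Complex.continuous_re.tendsto _).comp hT).const_mul 2 |>.const_mul (Real.exp (μ_ * t))
  -- finite blocks in `ite` form
  have hfin : ∀ (s : Finset (d → ℤ)) (μ_ : ℝ),
      Real.exp (μ_ * t₁) * (∑ k ∈ s, if χ k then ‖c k t₁‖ ^ 2 else 0) -
          Real.exp (μ_ * t₀) * (∑ k ∈ s, if χ k then ‖c k t₀‖ ^ 2 else 0) =
        ∫ t in t₀..t₁, Real.exp (μ_ * t) *
          (μ_ * (∑ k ∈ s, if χ k then ‖c k t‖ ^ 2 else 0) -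
            8 * Real.pi ^ 2 * κ * (∑ k ∈ s, if χ k then freqNormSq k * ‖c k t‖ ^ 2 else 0) -
            2 * (∑ k ∈ s, if χ k then conj (c k t) * f k t else 0).re) := by
    intro s μ_
    have key := exp_mul_sum_sq_sub_eq_integral h hlt (s.filter χ) μ_
    simp only [Finset.sum_filter] at key
    rw [hc_def, hf_def]
    simp only
    rw [key]
    congr 1; funext t
    rw [Complex.re_sum]
    congr 2
    · congr 1
      refine Finset.sum_congr rfl fun k _ => ?_
      split_ifs <;> simp
  -- continuity of the finite-block integrands (for integrability)
  have hcont_c : ∀ k, ContinuousOn (c k) S := fun k => continuousOn_mFourierCoeff_slice hws hS k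
  have hcont_f : ∀ k, ContinuousOn (f k) S := fun k => continuousOn_mFourierCoeff_slice hFs hS k
  have hcont_adv : ∀ s : Finset (d → ℤ),
      ContinuousOn (fun t => (∑ k ∈ s, if χ k then conj (c k t) * f k t else 0).re) S := by
    intro s
    refine Complex.continuous_re.comp_continuousOn (continuousOn_finsetSum s fun k _ => ?_)
    split_ifs
    · exact ((hcont_c k).star).mul (hcont_f k)
    · exact continuousOn_const
  have hcont_E : ∀ s : Finset (d → ℤ),
      ContinuousOn (fun t => ∑ k ∈ s, if χ k then ‖c k t‖ ^ 2 else 0) S := by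
    intro s
    refine continuousOn_finsetSum s fun k _ => ?_
    split_ifs
    · exact (hcont_c k).norm.pow 2
    · exact continuousOn_const
  have hcont_D : ∀ s : Finset (d → ℤ),
      ContinuousOn (fun t => ∑ k ∈ s, if χ k then freqNormSq k * ‖c k t‖ ^ 2 else 0) S := by
    intro s
    refine continuousOn_finsetSum s fun k _ => ?_
    split_ifs
    · exact continuousOn_const.mul ((hcont_c k).norm.pow 2)
    · exact continuousOn_const
  have hexpc : ∀ μ_ : ℝ, ContinuousOn (fun t => Real.exp (μ_ * t)) S := fun μ_ =>
    Real.continuous_exp.comp_continuousOn (continuousOn_const.mul continuousOn_id)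
  have hII : ∀ {g : ℝ → ℝ}, ContinuousOn g S → IntervalIntegrable g volume t₀ t₁ := fun hg =>
    (hg.mono (uIcc_of_le hlt.le).subset).intervalIntegrable
  -- (HIGH) weighted block energies are eventually non-increasing
  have hhigh_fin : ∀ s : Finset (d → ℤ),
      Real.exp (lam * t₁) * (∑ k ∈ s, if χ k then ‖c k t₁‖ ^ 2 else 0) -
          Real.exp (lam * t₀) * (∑ k ∈ s, if χ k then ‖c k t₀‖ ^ 2 else 0) ≤
        ∫ t in t₀..t₁, Real.exp (lam * t) * (-(2 * (∑ k ∈ s, if χ k then conj (c k t) * f k t else 0).re)) := by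
    intro s
    rw [hfin s lam]
    refine intervalIntegral.integral_mono_on hlt.le
      (hII ((hexpc lam).mul (((continuousOn_const.mul (hcont_E s)).sub
        (continuousOn_const.mul (hcont_D s))).sub (continuousOn_const.mul (hcont_adv s)))))
      (hII ((hexpc lam).mul ((continuousOn_const.mul (hcont_adv s)).neg)))
      fun t ht => ?_
    refine mul_le_mul_of_nonneg_left ?_ (Real.exp_pos _).le
    -- `λ E_A - 8π²κ D_A ≤ 0` termwise on the block
    have hle : lam * (∑ k ∈ s, if χ k then ‖c k t‖ ^ 2 else 0) ≤
        8 * Real.pi ^ 2 * κ * (∑ k ∈ s, if χ k then freqNormSq k * ‖c k t‖ ^ 2 else 0) := by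
      rw [hlam, Finset.mul_sum, Finset.mul_sum]
      refine Finset.sum_le_sum fun k _ => ?_
      split_ifs with hk
      · have hK2 : K ^ 2 ≤ freqNormSq k := by
          have h1 : K ^ 2 ≤ ((k i : ℤ) : ℝ) ^ 2 := by
            rw [← sq_abs ((k i : ℤ) : ℝ)]
            exact pow_le_pow_left₀ hK hk 2
          have h2 : ((k i : ℤ) : ℝ) ^ 2 ≤ freqNormSq k := by
            rw [freqNormSq]
            exact Finset.single_le_sum (f := fun j => ((k j : ℤ) : ℝ) ^ 2) (fun j _ => sq_nonneg _)
              (Finset.mem_univ i)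
          exact h1.trans h2
        have : 0 ≤ 8 * Real.pi ^ 2 * κ * ‖c k t‖ ^ 2 := by positivity
        nlinarith
      · simp
    linarith
  -- (LOW) `‖w‖² - E_A` is eventually non-increasing
  have hlow_fin : ∀ s : Finset (d → ℤ),
      (scalarL2Sq (w t₁) - ∑ k ∈ s, if χ k then ‖c k t₁‖ ^ 2 else 0) -
          (scalarL2Sq (w t₀) - ∑ k ∈ s, if χ k then ‖c k t₀‖ ^ 2 else 0) ≤
        ∫ t in t₀..t₁, Real.exp (0 * t) * (2 * (∑ k ∈ s, if χ k then conj (c k t) * f k t else 0).re) := by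
    intro s
    have key := hfin s 0
    simp only [zero_mul, Real.exp_zero, one_mul, zero_sub] at key
    have hen := IsClassicalScalarTransportOn.scalarL2Sq_add_scalarDissipation_holds h hlt.le subset_rfl
    have hGc : ContinuousOn (fun t => scalarGradNormSq (w t)) S := h.continuousOn_scalarGradNormSq hS hU
    -- `∫ (-8π²κ D_A - 2 Re adv_A) ≥ ∫ (-2κ G - 2 Re adv_A)`
    have hmono : (∫ t in t₀..t₁, (-(2 * κ * scalarGradNormSq (w t)) -
        2 * (∑ k ∈ s, if χ k then conj (c k t) * f k t else 0).re)) ≤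
        ∫ t in t₀..t₁, (-(8 * Real.pi ^ 2 * κ * ∑ k ∈ s, if χ k then freqNormSq k * ‖c k t‖ ^ 2 else 0) -
          2 * (∑ k ∈ s, if χ k then conj (c k t) * f k t else 0).re) := by
      refine intervalIntegral.integral_mono_on hlt.le
        (hII (((continuousOn_const.mul hGc).neg).sub (continuousOn_const.mul (hcont_adv s))))
        (hII (((continuousOn_const.mul (hcont_D s)).neg).sub (continuousOn_const.mul (hcont_adv s))))
        fun t ht => ?_
      have hD : 4 * Real.pi ^ 2 * (∑ k ∈ s, if χ k then freqNormSq k * ‖c k t‖ ^ 2 else 0) ≤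
          scalarGradNormSq (w t) := by
        have h1 := four_pi_sq_mul_sum_freqNormSq_mul_le_scalarGradNormSq (hws.isSmooth_slice ht) (s.filter χ)
        rw [Finset.sum_filter] at h1
        exact h1
      nlinarith
    have i1 : IntervalIntegrable (fun t => -(2 * κ * scalarGradNormSq (w t))) volume t₀ t₁ :=
      hII ((continuousOn_const.mul hGc).neg)
    have i2 : IntervalIntegrable (fun t => 2 * (∑ k ∈ s, if χ k then conj (c k t) * f k t else 0).re)
        volume t₀ t₁ := hII (continuousOn_const.mul (hcont_adv s))
    have hsplit : (∫ t in t₀..t₁, (-(2 * κ * scalarGradNormSq (w t)) -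
        2 * (∑ k ∈ s, if χ k then conj (c k t) * f k t else 0).re)) =
        -(2 * scalarDissipation κ w t₀ t₁) -
          ∫ t in t₀..t₁, 2 * (∑ k ∈ s, if χ k then conj (c k t) * f k t else 0).re := by
      rw [intervalIntegral.integral_sub i1 i2, intervalIntegral.integral_neg,
        intervalIntegral.integral_const_mul, scalarDissipation]
      ring
    simp only [zero_mul, Real.exp_zero, one_mul]
    rw [hsplit] at hmono
    linarith
  -- limits along finite sets
  have hE_tend : ∀ t ∈ S, Tendsto (fun s : Finset (d → ℤ) => ∑ k ∈ s, if χ k then ‖c k t‖ ^ 2 else 0)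
      atTop (𝓝 (EB t)) := fun t ht => hEsum t ht
  have ht₀ : t₀ ∈ S := left_mem_Icc.mpr hlt.le
  have ht₁ : t₁ ∈ S := right_mem_Icc.mpr hlt.le
  constructor
  · -- high block
    have hL : Tendsto (fun s : Finset (d → ℤ) =>
        Real.exp (lam * t₁) * (∑ k ∈ s, if χ k then ‖c k t₁‖ ^ 2 else 0) -
          Real.exp (lam * t₀) * (∑ k ∈ s, if χ k then ‖c k t₀‖ ^ 2 else 0)) atTop
        (𝓝 (Real.exp (lam * t₁) * EB t₁ - Real.exp (lam * t₀) * EB t₀)) :=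
      ((hE_tend t₁ ht₁).const_mul _).sub ((hE_tend t₀ ht₀).const_mul _)
    have hR : Tendsto (fun s : Finset (d → ℤ) => ∫ t in t₀..t₁,
        Real.exp (lam * t) * (-(2 * (∑ k ∈ s, if χ k then conj (c k t) * f k t else 0).re))) atTop (𝓝 0) := by
      have := (hDCT lam).neg
      rw [neg_zero] at this
      refine this.congr fun s => ?_
      rw [← intervalIntegral.integral_neg]
      congr 1; funext t; ring
    have := le_of_tendsto_of_tendsto' hL hR hhigh_fin
    rw [hlam] at this
    linarith
  · -- low block
    have hL : Tendsto (fun s : Finset (d → ℤ) =>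
        (scalarL2Sq (w t₁) - ∑ k ∈ s, if χ k then ‖c k t₁‖ ^ 2 else 0) -
          (scalarL2Sq (w t₀) - ∑ k ∈ s, if χ k then ‖c k t₀‖ ^ 2 else 0)) atTop
        (𝓝 ((scalarL2Sq (w t₁) - EB t₁) - (scalarL2Sq (w t₀) - EB t₀))) :=
      (tendsto_const_nhds.sub (hE_tend t₁ ht₁)).sub (tendsto_const_nhds.sub (hE_tend t₀ ht₀))
    have := le_of_tendsto_of_tendsto' hL (hDCT 0) hlow_fin
    linarith

/-- **Bare-rate damping of the high streamwise fibres** (real form): for a classical solution whose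
velocity on `[t₀, t₁]` is a shear along the `i`-th axis, independent of `xᵢ`,
`∑_{K ≤ |kᵢ|} |𝓕(w(t₁))(k)|² ≤ e^{-8π²κK²(t₁-t₀)} ∑_{K ≤ |kᵢ|} |𝓕(w(t₀))(k)|²` (`K ≥ 0`, `κ ≥ 0`).
[cite: BedrossianCotiZelati2017, §1 (the heat-rate bound for each streamwise frequency)] -/
theorem IsClassicalScalarTransportOn.tsum_high_le_exp_mul {S : Set ℝ} (h : IsClassicalScalarTransportOn S κ u w)
    (hκ : 0 ≤ κ) (hle : t₀ ≤ t₁) (hsub : Icc t₀ t₁ ⊆ S) (i : d)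
    (hdir : ∀ t ∈ Icc t₀ t₁, ∀ x, u t x = (u t x i) • EuclideanSpace.single i (1 : ℝ))
    (hinv : ∀ t ∈ Icc t₀ t₁, ∀ (s : UnitAddCircle) (x : UnitAddTorus d), u t (x + Pi.single i s) = u t x)
    {K : ℝ} (hK : 0 ≤ K) :
    (∑' k : d → ℤ, if K ≤ |((k i : ℤ) : ℝ)| then ‖mFourierCoeff (fun x => (w t₁ x : ℂ)) k‖ ^ 2 else 0) ≤
      Real.exp (-(8 * Real.pi ^ 2 * κ * K ^ 2 * (t₁ - t₀))) *
        (∑' k : d → ℤ, if K ≤ |((k i : ℤ) : ℝ)| then ‖mFourierCoeff (fun x => (w t₀ x : ℂ)) k‖ ^ 2 else 0) := by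
  rcases eq_or_lt_of_le hle with rfl | hlt
  · simp
  have hcore := (tsum_high_le_and_low_le (h.restrict_Icc hlt hsub) hlt hκ i hdir hinv hK).1
  set E₁ := ∑' k : d → ℤ, if K ≤ |((k i : ℤ) : ℝ)| then ‖mFourierCoeff (fun x => (w t₁ x : ℂ)) k‖ ^ 2 else 0
  set E₀ := ∑' k : d → ℤ, if K ≤ |((k i : ℤ) : ℝ)| then ‖mFourierCoeff (fun x => (w t₀ x : ℂ)) k‖ ^ 2 else 0
  have hpos := Real.exp_pos (8 * Real.pi ^ 2 * κ * K ^ 2 * t₁)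
  rw [show -(8 * Real.pi ^ 2 * κ * K ^ 2 * (t₁ - t₀)) =
      8 * Real.pi ^ 2 * κ * K ^ 2 * t₀ - 8 * Real.pi ^ 2 * κ * K ^ 2 * t₁ by ring, Real.exp_sub,
    div_mul_eq_mul_div, le_div_iff₀ hpos, mul_comm]
  exact hcore

/-- **The low block is non-increasing**: `‖w(t)‖²_{L²} - ∑_{K ≤ |kᵢ|} |𝓕(w(t))(k)|²` (the energy of the
fibres `|kᵢ| < K`) does not increase on `[t₀, t₁]`. [cite: BedrossianCotiZelati2017, §1] -/
theorem IsClassicalScalarTransportOn.scalarL2Sq_sub_tsum_high_le {S : Set ℝ}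
    (h : IsClassicalScalarTransportOn S κ u w) (hκ : 0 ≤ κ) (hle : t₀ ≤ t₁) (hsub : Icc t₀ t₁ ⊆ S) (i : d)
    (hdir : ∀ t ∈ Icc t₀ t₁, ∀ x, u t x = (u t x i) • EuclideanSpace.single i (1 : ℝ))
    (hinv : ∀ t ∈ Icc t₀ t₁, ∀ (s : UnitAddCircle) (x : UnitAddTorus d), u t (x + Pi.single i s) = u t x)
    {K : ℝ} (hK : 0 ≤ K) :
    scalarL2Sq (w t₁) -
        (∑' k : d → ℤ, if K ≤ |((k i : ℤ) : ℝ)| then ‖mFourierCoeff (fun x => (w t₁ x : ℂ)) k‖ ^ 2 else 0) ≤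
      scalarL2Sq (w t₀) -
        (∑' k : d → ℤ, if K ≤ |((k i : ℤ) : ℝ)| then ‖mFourierCoeff (fun x => (w t₀ x : ℂ)) k‖ ^ 2 else 0) := by
  rcases eq_or_lt_of_le hle with rfl | hlt
  · exact le_rfl
  exact (tsum_high_le_and_low_le (h.restrict_Icc hlt hsub) hlt hκ i hdir hinv hK).2

/-- **Bare-rate damping of the high fibres, `ℝ≥0∞` form.**
`E_{≥K}(w(t₁)) ≤ e^{-8π²κK²(t₁-t₀)} · E_{≥K}(w(t₀))` for the block energy `Torus.highModeEnergy`.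
[cite: BedrossianCotiZelati2017, §1] -/
theorem IsClassicalScalarTransportOn.highModeEnergy_le_exp_mul {S : Set ℝ}
    (h : IsClassicalScalarTransportOn S κ u w) (hκ : 0 ≤ κ) (hle : t₀ ≤ t₁) (hsub : Icc t₀ t₁ ⊆ S) (i : d)
    (hdir : ∀ t ∈ Icc t₀ t₁, ∀ x, u t x = (u t x i) • EuclideanSpace.single i (1 : ℝ))
    (hinv : ∀ t ∈ Icc t₀ t₁, ∀ (s : UnitAddCircle) (x : UnitAddTorus d), u t (x + Pi.single i s) = u t x)
    {K : ℝ} (hK : 0 ≤ K) :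
    highModeEnergy i K (w t₁) ≤
      ENNReal.ofReal (Real.exp (-(8 * Real.pi ^ 2 * κ * K ^ 2 * (t₁ - t₀)))) * highModeEnergy i K (w t₀) := by
  have ht₀ : t₀ ∈ S := hsub (left_mem_Icc.mpr hle)
  have ht₁ : t₁ ∈ S := hsub (right_mem_Icc.mpr hle)
  rw [highModeEnergy_eq_ofReal_tsum (h.smooth_scalar.isSmooth_slice ht₁).continuous,
    highModeEnergy_eq_ofReal_tsum (h.smooth_scalar.isSmooth_slice ht₀).continuous,
    ← ENNReal.ofReal_mul (Real.exp_pos _).le]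
  exact ENNReal.ofReal_le_ofReal (h.tsum_high_le_exp_mul hκ hle hsub i hdir hinv hK)

/-- **The form consumed by the cell `ad-ideate`** (route `SawtoothPulseCascade`, line
`K1LocalisedCascade.Spectral`, stub S2 `stub_shearSlotDamping`, with the necessary side condition `0 ≤ K`):
across a time slot on which the velocity is an `xᵢ`-independent shear along the `i`-th axis, a classical
scalar loses at least the fraction `1 - e^{-8π²κK²(t₁-t₀)}` of the energy it carried in the fibres
`|kᵢ| ≥ K`: `‖w(t₁)‖² + (1 - e^{-8π²κK²(t₁-t₀)}) · E_{≥K}(w(t₀)) ≤ ‖w(t₀)‖²` in `ℝ≥0∞`.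
[cite: BedrossianCotiZelati2017, §1 (streamwise decoupling; heat-rate decay of each mode)] -/
theorem IsClassicalScalarTransportOn.scalarL2Sq_add_highModeEnergy_le {S : Set ℝ}
    (h : IsClassicalScalarTransportOn S κ u w) (hκ : 0 ≤ κ) (hle : t₀ ≤ t₁) (hsub : Icc t₀ t₁ ⊆ S) (i : d)
    (hdir : ∀ t ∈ Icc t₀ t₁, ∀ x, u t x = (u t x i) • EuclideanSpace.single i (1 : ℝ))
    (hinv : ∀ t ∈ Icc t₀ t₁, ∀ (s : UnitAddCircle) (x : UnitAddTorus d), u t (x + Pi.single i s) = u t x)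
    {K : ℝ} (hK : 0 ≤ K) :
    ENNReal.ofReal (scalarL2Sq (w t₁)) +
        ENNReal.ofReal (1 - Real.exp (-(8 * Real.pi ^ 2 * κ * K ^ 2 * (t₁ - t₀)))) * highModeEnergy i K (w t₀) ≤
      ENNReal.ofReal (scalarL2Sq (w t₀)) := by
  have ht₀ : t₀ ∈ S := hsub (left_mem_Icc.mpr hle)
  set E₁ := ∑' k : d → ℤ, if K ≤ |((k i : ℤ) : ℝ)| then ‖mFourierCoeff (fun x => (w t₁ x : ℂ)) k‖ ^ 2 else 0
    with hE₁
  set E₀ := ∑' k : d → ℤ, if K ≤ |((k i : ℤ) : ℝ)| then ‖mFourierCoeff (fun x => (w t₀ x : ℂ)) k‖ ^ 2 else 0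
    with hE₀
  have hhigh := h.tsum_high_le_exp_mul hκ hle hsub i hdir hinv hK
  have hlow := h.scalarL2Sq_sub_tsum_high_le hκ hle hsub i hdir hinv hK
  have hE₀nn : 0 ≤ E₀ := tsum_nonneg fun k => by split_ifs <;> positivity
  have hq : 0 ≤ 1 - Real.exp (-(8 * Real.pi ^ 2 * κ * K ^ 2 * (t₁ - t₀))) := by
    rw [sub_nonneg, Real.exp_le_one_iff, neg_nonpos]
    have : 0 ≤ t₁ - t₀ := sub_nonneg.mpr hle
    positivity
  rw [highModeEnergy_eq_ofReal_tsum (h.smooth_scalar.isSmooth_slice ht₀).continuous, ← hE₀,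
    ← ENNReal.ofReal_mul hq, ← ENNReal.ofReal_add (scalarL2Sq_nonneg _) (mul_nonneg hq hE₀nn)]
  refine ENNReal.ofReal_le_ofReal ?_
  rw [← hE₁] at hhigh hlow
  nlinarith

end Main

end Torus

end Literature.Analysis.FluidPDE
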